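/-
Copyright: the b2b-balaban T⁴-continuum CRUX team, row NE7b leaf lineage `t4-ne7b-formalise-leaf-01` (gen 87). Project licence.
-/
import Summits.QuantumFields.BalabanUV.T4Continuum.Spine.NE7b.BlockSectionRowSumKernelSums
import Summits.QuantumFields.BalabanUV.T4Continuum.Spine.NE7b.BlockSectionRowSumKernelFacts

/-!
# THE ROW-SUM NUMBER OF THE SIDE-2 ONE-SHOT SECTION ON `ℤ⁴` AT FULL KERNEL WEIGHT — NO `native_decide`: `Σ'_y |kerH 1 a p y| ≤ 2587∕1000 < 1 + √3`,
# axioms = {propext, Classical.choice, Quot.sound} (row NE7b, node U5c; FILE 4∕4: the bridges to `BlockSectionRowSumCertificate.rowSum_certificate` at `t = 7∕5`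
# and the value; the trio-only twin of `BlockSectionRowSumValue.rowSum_value` (p392013, `2594∕1000` modulo `native_decide`); [folklore] + kernel computation)

Cell `pub-balaban`, sub-cell `t4`, spine estimate NE7b (`T4WeightBudget.RelWeightBound`; the cell's OWN estimate — NOT PRINTED in [Bałaban 1983–89], NOT
PROVED).  Crux-route work under `Spine/NE7b/` by a row leaf (`t4-ne7b-formalise-leaf-01` gen 87) under FREEZE (0)'s crux-prover clause; NOTHING of Bałaban's
is named as a Lean object, valued or asserted; no `T4Continuum/Support` leaf typed; zero `sorry`.  No `def` in this file.  Imports: files 2∕4 `BlockSectionRowSumKernelSums` and 3∕4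
`BlockSectionRowSumKernelFacts` (the kernel-evaluated facts and the generic box bridges; through them file 1∕4, this lineage's `BlockSectionRowSumValue` for the box vocabulary `rng ∕ Sbox ∕ boxB ∕
boxT ∕ chart_one_apply`, and `BlockSectionRowSumCertificate` — the socket `rowSum_certificate`, the engine, the letter, the side-2 gap and `B5Hk103ScalarZd.kerH`).

WHY.  See file 1∕4: the same competitor as CERT-1 ∕ BSRV (495 orbit values over `2⁴⁴`, refuter CONCUR no. 22), evaluated by the KERNEL instead of the compiler,
at the weight `t = 7∕5` (`m = 2 − 4·((t + t⁻¹)∕2 − 1) = 62/35`, `√(((t²+1)∕(t²−1))⁴) = 1369/144`), which prices CERT-1's competitor at `2.586288793`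
(g86's `t = 3∕2`: `2.593990559`).  By T-111 L1–L3 ∕ OSCML2's pattern this gives `K_mix(2)² ≤ 1 + 1.587² < 4` with NO compiler trust (that junction is
leaf-06's ∕ the OWNER's, not here).  THIS FILE: the letter's hypotheses for the competitor `φ = phiZ∕2⁴⁴` — support `[−8, 9]⁴` (`phi_support`), exact block sums
(`blockSums_phi`, from the kernel's `blockRow_all`), the residual window `[−5, 5]⁴` (`residual_support`) — and its right side: the near field bounded by the
kernel's class sums (`nearField_le`: the row over the residue class of `p` reindexed to `[−4, 4]⁴`), the weighted residual sum identified with the kernel's folded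
integer `S2num ∕ 5⁴⁰` (`residualNorm_eq`, `S2Q_eq` — the fold uses the evenness `resSq4_neg₀…₃` of file 1∕4 coordinate by coordinate, `fold_rng`), then
`rowSum_certificate` and arithmetic.

WHAT IS PROVED: `phi_support`, `blockSum_eq`, `blockSums_computed`, `blockSums_phi`, `lapRow_phi`, `lapZ_eq_zero_far`, `residual_support`, `classSum_eq`,
`classSum_le`, `nearField_le`, `residualNorm_eq`, `S2Q_term`, `S2Q_term_even`, `weight_eq`, `S2num_eq_finset`, `S2Q_eq` [folklore bookkeeping];
§4 **`rowSum_value`**: `∀ a > 0, ∀ p, Summable (|kerH 1 a p ·|) ∧ Σ'_y |kerH 1 a p y| ≤ 2587∕1000`.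

HONEST: [folklore] + kernel computation (axioms ⊆ {propext, Classical.choice, Quot.sound} — no `Lean.ofReduceBool`); the competitor is data, not
Bałaban's object; scalar `U = 1` block-MEAN skeleton on `ℤ⁴`; nothing of (A3) ∕ NC-NE7b-α; BY-NAME EFFECT ON THE WALL: NONE.  NE7b NOT PRINTED ∕ NOT PROVED;
spine PROVED 0∕9; rung (B)+1 on a FINITE torus — NOT infinite volume, NOT the mass gap, NOT Clay.  HONEST DEPENDENCY: continuum YM on T⁴ ⇐ BetaPertH ∧ nine
spine estimates (0∕9 proved); BetaPertH ⇐ (D1) ∧ (D4) ∧ CAP+tail; G-an2-4 gates asym, D1 and NE2∕3∕4.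
-/

set_option autoImplicit false

namespace Summit.QuantumFields.BalabanUV.T4Continuum.NE7b.BlockSectionRowSumKernel

open Finset
open Literature.MathematicalPhysics.QuantumFieldTheory.Balaban1983to89
open B6QGQLower276 (X B e blk chart side loc mem_B sum_B blk_chart U mem_U sum_U side_mul_blk_add_loc loc_nonneg loc_le e_apply_self e_apply_ne)
open B5Hk103ScalarZd (kerH)
open B5Hk103Unique (lapRow)
open B5Hk165TranslZd (bshift)
open Summit.QuantumFields.BalabanUV.T4Continuum.NE7b.BlockSectionAgmonEngine (blk_sub_bshift sub_bshift_injective)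
open Summit.QuantumFields.BalabanUV.T4Continuum.NE7b.BlockSectionRowSumCertificate (rowSum_certificate)
open Summit.QuantumFields.BalabanUV.T4Continuum.NE7b.BlockSectionRowSumValue (rng mem_rng Sbox boxB boxT chart_one_apply)
open Summit.QuantumFields.BalabanUV.T4Continuum.NE7b.BlockSectionRowSumKernelData
open Summit.QuantumFields.BalabanUV.T4Continuum.NE7b.BlockSectionRowSumKernelSums
open Summit.QuantumFields.BalabanUV.T4Continuum.NE7b.BlockSectionRowSumKernelFacts

/-! ## §3  Bridges: generic box sums, the letter's hypotheses, and its right side [folklore bookkeeping] -/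

/-- The competitor is supported in `Sbox`. -/
theorem phi_support : ∀ q ∉ Sbox, phi q = 0 := by
  intro q hq
  have h : ¬ (∀ μ : Fin 4, -8 ≤ q μ ∧ q μ ≤ 9) := by
    intro hall
    apply hq
    rw [Sbox, Fintype.mem_piFinset]
    intro μ
    rw [mem_rng]
    have := hall μ; omega
  simp [phi, phiZ_eq_zero h]

/-- The `Finset` block sum of the numerators is the kernel's `blockSum4`. -/
theorem blockSum_eq (b : X 4) : ∑ z : Fin 4 → Fin 2, phiZ (chart 1 b z) = blockSum4 (b 0) (b 1) (b 2) (b 3) := by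
  rw [sum_univ_fin4_fin2]
  simp only [phiZ, chart_one_apply, blockSum4, sites16, List.sum_cons, List.sum_nil, Matrix.cons_val_zero, Matrix.cons_val_one, Matrix.cons_val,
    Fin.isValue, Fin.val_zero, Fin.val_one, Nat.cast_zero, Nat.cast_one, add_zero]
  ring

/-- The block sums on the `9⁴` support blocks, from the kernel's check. -/
theorem blockSums_computed (b : X 4) (hb : b ∈ boxB) :
    (∑ z : Fin 4 → Fin 2, phiZ (chart 1 b z)) = if b = 0 then 2 ^ 48 else 0 := by
  rw [blockSum_eq]
  rw [boxB, Fintype.mem_piFinset] at hb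
  have hμ : ∀ μ : Fin 4, ∃ i : ℕ, i < 9 ∧ b μ = -4 + i := fun μ => by
    have := mem_rng.1 (hb μ); exact ⟨(b μ + 4).toNat, by omega, by omega⟩
  obtain ⟨i₀, hi₀, h₀⟩ := hμ 0
  obtain ⟨i₁, hi₁, h₁⟩ := hμ 1
  obtain ⟨i₂, hi₂, h₂⟩ := hμ 2
  obtain ⟨i₃, hi₃, h₃⟩ := hμ 3
  have hb₀ : b = 0 ↔ (b 0 = 0 ∧ b 1 = 0 ∧ b 2 = 0 ∧ b 3 = 0) := by
    constructor
    · rintro rfl; simp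
    · rintro ⟨e0, e1, e2, e3⟩
      rw [eq_vec4 b, e0, e1, e2, e3]
      funext i; fin_cases i <;> rfl
  have h := blockRow_all i₀ hi₀
  simp only [blockRow, List.all_eq_true, List.mem_range, beq_iff_eq] at h
  rw [h₀, h₁, h₂, h₃, h i₁ hi₁ i₂ hi₂ i₃ hi₃]
  simp only [hb₀, h₀, h₁, h₂, h₃]

/-- **Exact block sums**: `Σ_{q∈B(y)} φ q = 2⁴·δ_{y0}` for EVERY block `y`. -/
theorem blockSums_phi : ∀ y : X 4, ∑ q ∈ B 1 y, phi q = (2 : ℝ) ^ 4 * (if y = 0 then 1 else 0) := by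
  classical
  intro y
  rw [sum_B]
  have hsum : ∑ z : Fin 4 → Fin 2, phi (chart 1 y z) = ((∑ z : Fin 4 → Fin 2, phiZ (chart 1 y z) : ℤ) : ℝ) / 2 ^ 44 := by
    simp only [phi]; push_cast; rw [Finset.sum_div]
  rw [hsum]
  by_cases hy : y ∈ boxB
  · rw [blockSums_computed y hy]
    split_ifs <;> norm_num
  · have hne : y ≠ 0 := by
      rintro rfl; apply hy
      rw [boxB, Fintype.mem_piFinset]; intro μ; rw [mem_rng]; simp
    have hμ : ∃ μ : Fin 4, y μ < -4 ∨ 4 < y μ := by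
      by_contra hcon
      apply hy
      rw [boxB, Fintype.mem_piFinset]; intro μ; rw [mem_rng]; have := not_exists.mp hcon μ; omega
    obtain ⟨μ, hμ⟩ := hμ
    have hz : ∀ z : Fin 4 → Fin 2, phiZ (chart 1 y z) = 0 := by
      intro z
      apply phiZ_eq_zero
      intro hall
      have h1 := hall μ
      rw [chart_one_apply] at h1
      have h2 : ((z μ : ℕ) : ℤ) < 2 := by have := (z μ).isLt; omega
      have h3 : (0 : ℤ) ≤ ((z μ : ℕ) : ℤ) := by positivity
      omega
    simp [hz, hne]

/-- The letter's Laplacian row of `φ` is the integer row over `2⁴⁴`. -/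
theorem lapRow_phi (q : X 4) : lapRow phi q = (lapZ q : ℝ) / 2 ^ 44 := by
  simp only [lapRow, phi, lapZ]
  push_cast
  rw [Finset.sum_div]
  refine Finset.sum_congr rfl fun μ _ => ?_
  ring

/-- Far blocks carry no Laplacian: if some block coordinate has `|·| ≥ 6`, every site `r` of that block has `lapZ r = 0`. -/
theorem lapZ_eq_zero_far {r : X 4} {μ : Fin 4} (h : blk 1 r μ ≤ -6 ∨ 6 ≤ blk 1 r μ) : lapZ r = 0 := by
  have hr : side 1 * blk 1 r μ + loc 1 r μ = r μ := side_mul_blk_add_loc 1 r μ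
  have hl0 : 0 ≤ loc 1 r μ := loc_nonneg 1 r μ
  have hl1 : loc 1 r μ ≤ 1 := by have := loc_le 1 r μ; exact_mod_cast this
  have hs : side 1 = 2 := by simp [side]
  rw [hs] at hr
  have h0 : ∀ q : X 4, (q μ ≤ -10 ∨ 11 ≤ q μ) → phiZ q = 0 := fun q hq =>
    phiZ_eq_zero fun hall => by have := hall μ; omega
  have hc : phiZ r = 0 := h0 r (by omega)
  have hp : ∀ ν : Fin 4, phiZ (r + e ν) = 0 := by
    intro ν; apply h0
    by_cases hν : μ = ν
    · subst hν; rw [Pi.add_apply, e_apply_self]; omega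
    · rw [Pi.add_apply, e_apply_ne hν]; omega
  have hm : ∀ ν : Fin 4, phiZ (r - e ν) = 0 := by
    intro ν; apply h0
    by_cases hν : μ = ν
    · subst hν; rw [Pi.sub_apply, e_apply_self]; omega
    · rw [Pi.sub_apply, e_apply_ne hν]; omega
  simp [lapZ, hc, hp, hm]

/-- **Residual window**: the mean-removed Laplacian of `φ` vanishes off the blocks `[−5, 5]⁴`. -/
theorem residual_support : ∀ q ∉ U 1 boxT,
    lapRow phi q - ((2 : ℝ) ^ 4)⁻¹ * ∑ r ∈ B 1 (blk 1 q), lapRow phi r = 0 := by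
  intro q hq
  rw [mem_U] at hq
  have hμ : ∃ μ : Fin 4, blk 1 q μ ≤ -6 ∨ 6 ≤ blk 1 q μ := by
    by_contra hcon
    apply hq
    rw [boxT, Fintype.mem_piFinset]; intro μ; rw [mem_rng]; have := not_exists.mp hcon μ; omega
  obtain ⟨μ, hμ⟩ := hμ
  have h1 : lapRow phi q = 0 := by rw [lapRow_phi, lapZ_eq_zero_far hμ]; simp
  have h2 : ∀ r ∈ B 1 (blk 1 q), lapRow phi r = 0 := by
    intro r hr
    have hb : blk 1 r = blk 1 q := mem_B.1 hr
    rw [lapRow_phi, lapZ_eq_zero_far (μ := μ) (by rw [hb]; exact hμ)]; simp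
  rw [h1, Finset.sum_eq_zero h2]; simp

/-- The class sums over the support blocks, `Finset` form = kernel form. -/
theorem classSum_eq (c : X 4) :
    ∑ w ∈ boxB, |phiZ (fun μ => c μ + 2 * w μ)| = classSum4 (c 0) (c 1) (c 2) (c 3) := by
  rw [boxB, sum_piFinset_fin4]
  simp only [sum_rng_eq_listSum, phiZ, classSum4, Matrix.cons_val_zero, Matrix.cons_val_one, Matrix.cons_val]

/-- The sixteen class sums from the kernel's check: for `c ∈ {0,1}⁴`, `classSum4 c ≤ 44770439763378`. -/
theorem classSum_le (c : X 4) (hc : ∀ μ, c μ = 0 ∨ c μ = 1) : classSum4 (c 0) (c 1) (c 2) (c 3) ≤ 44770439763378 := by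
  have hμ : ∀ μ : Fin 4, ∃ i : ℕ, i < 2 ∧ c μ = (i : ℤ) := fun μ => by
    rcases hc μ with h0 | h1
    · exact ⟨0, by omega, by simp [h0]⟩
    · exact ⟨1, by omega, by simp [h1]⟩
  obtain ⟨i₀, hi₀, h₀⟩ := hμ 0
  obtain ⟨i₁, hi₁, h₁⟩ := hμ 1
  obtain ⟨i₂, hi₂, h₂⟩ := hμ 2
  obtain ⟨i₃, hi₃, h₃⟩ := hμ 3
  have h := classCheck2_all i₀ i₁ hi₀ hi₁
  simp only [classCheck2, List.all_eq_true, List.mem_range, decide_eq_true_eq] at h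
  rw [h₀, h₁, h₂, h₃]
  exact h i₂ hi₂ i₃ hi₃

/-- **Near field**: for every `p`, the competitor's row over the residue class of `p` is one of the sixteen class sums:
`Σ_{y∈Y_p} |φ(p − 2y)| ≤ 44770439763378∕2⁴⁴`. -/
theorem nearField_le (p : X 4) :
    ∑ y ∈ (Sbox.image (blk 1)).image (fun b => blk 1 p - b), |phi (p - bshift 1 y)| ≤ 44770439763378 / 2 ^ 44 := by
  classical
  set Yp := (Sbox.image (blk 1)).image (fun b => blk 1 p - b) with hYp
  -- the residue class of `p`
  set c : X 4 := fun μ => loc 1 p μ with hc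
  have hc01 : ∀ μ, c μ = 0 ∨ c μ = 1 := by
    intro μ
    have h0 : 0 ≤ loc 1 p μ := loc_nonneg 1 p μ
    have h1 : loc 1 p μ ≤ 1 := by have := loc_le 1 p μ; exact_mod_cast this
    simp only [hc]; omega
  have hs : side 1 = 2 := by simp [side]
  have hp : ∀ μ, p μ = 2 * blk 1 p μ + c μ := by
    intro μ
    have := side_mul_blk_add_loc 1 p μ
    rw [hs] at this
    simp only [hc]; linarith
  -- the row reindexed over the box of blocks: y = blk p − w
  have hbshift : ∀ (y : X 4) (μ : Fin 4), (p - bshift 1 y) μ = p μ - 2 * y μ := by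
    intro y μ; simp [bshift, two_mul]
  have hsite : ∀ w : X 4, p - bshift 1 (blk 1 p - w) = fun μ => c μ + 2 * w μ := by
    intro w; funext μ; rw [hbshift, Pi.sub_apply, hp μ]; ring
  have hinj : Set.InjOn (fun w : X 4 => blk 1 p - w) ↑boxB := by
    intro w₁ _ w₂ _ h; simpa using h
  -- every term of the row with `φ ≠ 0` comes from a `w ∈ boxB`
  have hzero : ∀ y ∈ Yp, y ∉ boxB.image (fun w => blk 1 p - w) → |phi (p - bshift 1 y)| = 0 := by
    intro y _ hy
    rw [abs_eq_zero]
    have hout : ¬ (∀ μ : Fin 4, -8 ≤ (p - bshift 1 y) μ ∧ (p - bshift 1 y) μ ≤ 9) := by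
      intro hall
      apply hy
      rw [Finset.mem_image]
      refine ⟨blk 1 p - y, ?_, by simp⟩
      rw [boxB, Fintype.mem_piFinset]
      intro μ
      rw [mem_rng, Pi.sub_apply]
      have h1 := hall μ
      rw [hbshift, hp μ] at h1
      rcases hc01 μ with h0 | h0 <;> rw [h0] at h1 <;> omega
    simp [phi, phiZ_eq_zero hout]
  have hle : ∑ y ∈ Yp, |phi (p - bshift 1 y)| ≤ ∑ y ∈ boxB.image (fun w => blk 1 p - w), |phi (p - bshift 1 y)| := by
    rw [← Finset.sum_filter_add_sum_filter_not Yp (fun y => y ∈ boxB.image (fun w => blk 1 p - w))]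
    have h0 : ∑ y ∈ Yp.filter (fun y => ¬ y ∈ boxB.image (fun w => blk 1 p - w)), |phi (p - bshift 1 y)| = 0 :=
      Finset.sum_eq_zero fun y hy => hzero y (Finset.mem_filter.1 hy).1 (Finset.mem_filter.1 hy).2
    rw [h0, add_zero]
    exact Finset.sum_le_sum_of_subset_of_nonneg (fun y hy => (Finset.mem_filter.1 hy).2) fun y _ _ => abs_nonneg _
  have hbox : ∑ y ∈ boxB.image (fun w => blk 1 p - w), |phi (p - bshift 1 y)| = ∑ w ∈ boxB, |phi (fun μ => c μ + 2 * w μ)| := by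
    rw [Finset.sum_image hinj]
    exact Finset.sum_congr rfl fun w _ => by rw [hsite]
  have hcast : ∑ w ∈ boxB, |phi (fun μ => c μ + 2 * w μ)| = ((∑ w ∈ boxB, |phiZ (fun μ => c μ + 2 * w μ)| : ℤ) : ℝ) / 2 ^ 44 := by
    push_cast
    rw [Finset.sum_div]
    refine Finset.sum_congr rfl fun w _ => ?_
    rw [phi, abs_div, abs_of_pos (by positivity : (0 : ℝ) < 2 ^ 44)]
  refine hle.trans ?_
  rw [hbox, hcast, div_le_div_iff_of_pos_right (by positivity : (0 : ℝ) < 2 ^ 44), classSum_eq]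
  exact_mod_cast classSum_le c hc01

/-- **The weighted residual sum is `S2Q∕2⁹⁶`.** -/
theorem residualNorm_eq :
    ∑ q ∈ U 1 boxT, (((7 : ℝ) / 5) ^ (∑ μ, ((blk 1 q) μ).natAbs) *
        (lapRow phi q - ((2 : ℝ) ^ 4)⁻¹ * ∑ r ∈ B 1 (blk 1 q), lapRow phi r)) ^ 2 = (S2Q : ℝ) / 2 ^ 96 := by
  classical
  rw [sum_U]
  have hblock : ∀ b : X 4, ∑ q ∈ B 1 b, (((7 : ℝ) / 5) ^ (∑ μ, ((blk 1 q) μ).natAbs) *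
      (lapRow phi q - ((2 : ℝ) ^ 4)⁻¹ * ∑ r ∈ B 1 (blk 1 q), lapRow phi r)) ^ 2 =
      ((7 : ℝ) / 5) ^ (2 * ∑ μ, (b μ).natAbs) * (resSqZ b : ℝ) / 2 ^ 96 := by
    intro b
    have hin : ∀ q ∈ B 1 b, (((7 : ℝ) / 5) ^ (∑ μ, ((blk 1 q) μ).natAbs) *
        (lapRow phi q - ((2 : ℝ) ^ 4)⁻¹ * ∑ r ∈ B 1 (blk 1 q), lapRow phi r)) ^ 2 =
        (((7 : ℝ) / 5) ^ (∑ μ, (b μ).natAbs) *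
        (lapRow phi q - ((2 : ℝ) ^ 4)⁻¹ * ∑ r ∈ B 1 b, lapRow phi r)) ^ 2 := by
      intro q hq; rw [mem_B.1 hq]
    rw [Finset.sum_congr rfl hin, sum_B]
    have hs : ∑ r ∈ B 1 b, lapRow phi r = ((∑ z' : Fin 4 → Fin 2, lapZ (chart 1 b z') : ℤ) : ℝ) / 2 ^ 44 := by
      rw [sum_B]; simp only [lapRow_phi]; push_cast; rw [Finset.sum_div]
    simp only [hs]
    simp only [lapRow_phi, resSqZ]
    push_cast
    rw [eq_div_iff (by positivity : (2 : ℝ) ^ 96 ≠ 0), Finset.sum_mul, Finset.mul_sum]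
    refine Finset.sum_congr rfl fun z _ => ?_
    rw [pow_mul']
    ring
  rw [Finset.sum_congr rfl fun b _ => hblock b]
  simp only [S2Q]
  push_cast
  rw [Finset.sum_div]

/-- The summand of `S2Q` at the vector `![a, b, c, d]`, as a function of four integers. -/
theorem S2Q_term (a b c d : ℤ) :
    ((7 : ℚ) / 5) ^ (2 * ∑ μ : Fin 4, ((![a, b, c, d] : X 4) μ).natAbs) * (resSqZ ![a, b, c, d] : ℚ) =
      ((7 : ℚ) / 5) ^ (2 * (a.natAbs + b.natAbs + c.natAbs + d.natAbs)) * (resSq4 a b c d : ℚ) := by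
  simp only [resSqZ_eq, Fin.sum_univ_four, Fin.isValue, Matrix.cons_val_zero, Matrix.cons_val_one, Matrix.cons_val]

/-- The four-integer summand is even in each coordinate. -/
theorem S2Q_term_even (a b c d : ℤ) :
    (fun a b c d : ℤ => ((7 : ℚ) / 5) ^ (2 * (a.natAbs + b.natAbs + c.natAbs + d.natAbs)) * (resSq4 a b c d : ℚ)) (-a) b c d =
      (fun a b c d : ℤ => ((7 : ℚ) / 5) ^ (2 * (a.natAbs + b.natAbs + c.natAbs + d.natAbs)) * (resSq4 a b c d : ℚ)) a b c d ∧
    (fun a b c d : ℤ => ((7 : ℚ) / 5) ^ (2 * (a.natAbs + b.natAbs + c.natAbs + d.natAbs)) * (resSq4 a b c d : ℚ)) a (-b) c d =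
      (fun a b c d : ℤ => ((7 : ℚ) / 5) ^ (2 * (a.natAbs + b.natAbs + c.natAbs + d.natAbs)) * (resSq4 a b c d : ℚ)) a b c d ∧
    (fun a b c d : ℤ => ((7 : ℚ) / 5) ^ (2 * (a.natAbs + b.natAbs + c.natAbs + d.natAbs)) * (resSq4 a b c d : ℚ)) a b (-c) d =
      (fun a b c d : ℤ => ((7 : ℚ) / 5) ^ (2 * (a.natAbs + b.natAbs + c.natAbs + d.natAbs)) * (resSq4 a b c d : ℚ)) a b c d ∧
    (fun a b c d : ℤ => ((7 : ℚ) / 5) ^ (2 * (a.natAbs + b.natAbs + c.natAbs + d.natAbs)) * (resSq4 a b c d : ℚ)) a b c (-d) =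
      (fun a b c d : ℤ => ((7 : ℚ) / 5) ^ (2 * (a.natAbs + b.natAbs + c.natAbs + d.natAbs)) * (resSq4 a b c d : ℚ)) a b c d := by
  simp only [Int.natAbs_neg, resSq4_neg₀, resSq4_neg₁, resSq4_neg₂, resSq4_neg₃, and_self]

/-- On the orthant `[0,5]⁴` the folded rational weight is the kernel's integer weight over `5⁴⁰`. -/
theorem weight_eq (a b c d : ℤ) (ha : a ∈ rng 0 6) (hb : b ∈ rng 0 6) (hc : c ∈ rng 0 6) (hd : d ∈ rng 0 6) :
    (if a = 0 then (1 : ℚ) else 2) * ((if b = 0 then (1 : ℚ) else 2) * ((if c = 0 then (1 : ℚ) else 2) * ((if d = 0 then (1 : ℚ) else 2) *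
      (((7 : ℚ) / 5) ^ (2 * (a.natAbs + b.natAbs + c.natAbs + d.natAbs)) * (resSq4 a b c d : ℚ))))) =
      ((wZ4 a b c d : ℤ) : ℚ) * ((resSq4 a b c d : ℤ) : ℚ) / (5 : ℚ) ^ 40 := by
  rw [mem_rng] at ha hb hc hd
  obtain ⟨k, hk⟩ : ∃ k : ℕ, 20 = a.natAbs + b.natAbs + c.natAbs + d.natAbs + k := Nat.exists_eq_add_of_le (by omega)
  have h20 : 20 - (a.natAbs + b.natAbs + c.natAbs + d.natAbs) = k := by omega
  simp only [wZ4, h20]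
  push_cast
  rw [pow_mul, div_pow, show ((7 : ℚ) ^ 2) = 49 by norm_num, show ((5 : ℚ) ^ 2) = 25 by norm_num, div_pow,
    show ((5 : ℚ) ^ 40) = 25 ^ (a.natAbs + b.natAbs + c.natAbs + d.natAbs) * 25 ^ k by
      rw [← pow_add, ← hk]; norm_num]
  have h1 : ((25 : ℚ) ^ (a.natAbs + b.natAbs + c.natAbs + d.natAbs)) ≠ 0 := by positivity
  have h2 : ((25 : ℚ) ^ k) ≠ 0 := by positivity
  field_simp

/-- `S2num` in `Finset` form. -/
theorem S2num_eq_finset : S2num = ∑ a ∈ rng 0 6, ∑ b ∈ rng 0 6, ∑ c ∈ rng 0 6, ∑ d ∈ rng 0 6, wZ4 a b c d * resSq4 a b c d := by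
  simp only [sum_rng_eq_listSum, S2num, S2slab, zero_add]

/-- **`S2Q` is the kernel's folded integer sum over `5⁴⁰`.** -/
theorem S2Q_eq : S2Q = (S2num : ℚ) / (5 : ℚ) ^ 40 := by
  have hev := S2Q_term_even
  simp only at hev
  rw [S2Q, boxT, sum_piFinset_fin4]
  simp only [S2Q_term]
  -- fold the four coordinates, outermost first
  rw [fold_rng _ (fun a => by simp only [(hev a _ _ _).1])]
  have step1 : ∀ a : ℤ, ∑ b ∈ rng (-5) 11, ∑ c ∈ rng (-5) 11, ∑ d ∈ rng (-5) 11,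
      ((7 : ℚ) / 5) ^ (2 * (a.natAbs + b.natAbs + c.natAbs + d.natAbs)) * (resSq4 a b c d : ℚ) =
      ∑ b ∈ rng 0 6, (if b = 0 then (1 : ℚ) else 2) * ∑ c ∈ rng 0 6, (if c = 0 then (1 : ℚ) else 2) * ∑ d ∈ rng 0 6, (if d = 0 then (1 : ℚ) else 2) *
        (((7 : ℚ) / 5) ^ (2 * (a.natAbs + b.natAbs + c.natAbs + d.natAbs)) * (resSq4 a b c d : ℚ)) := by
    intro a
    rw [fold_rng _ (fun b => by simp only [(hev a b _ _).2.1])]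
    refine Finset.sum_congr rfl fun b _ => ?_
    congr 1
    rw [fold_rng _ (fun c => by simp only [(hev a b c _).2.2.1])]
    refine Finset.sum_congr rfl fun c _ => ?_
    congr 1
    rw [fold_rng _ (fun d => by simp only [(hev a b c d).2.2.2])]
  simp only [step1, Finset.mul_sum]
  rw [S2num_eq_finset]
  push_cast
  simp only [Finset.sum_div]
  refine Finset.sum_congr rfl fun a ha => Finset.sum_congr rfl fun b hb => Finset.sum_congr rfl fun c hc => Finset.sum_congr rfl fun d hd => ?_
  exact weight_eq a b c d ha hb hc hd

/-! ## §4  The value at full kernel weight [folklore + kernel computation] -/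

/-- **THE NUMBER, TRIO-ONLY**: for every `a > 0` and every fine site `p`, the coarse row of the side-2 one-shot block-mean section on `ℤ⁴` is summable and
`Σ'_y |kerH 1 a p y| ≤ 2587∕1000 (< 1 + √3 = 2.7320…)`.  Axioms: `propext`, `Classical.choice`, `Quot.sound` — no `Lean.ofReduceBool`. -/
theorem rowSum_value {a : ℝ} (ha : 0 < a) (p : X 4) :
    Summable (fun y => |kerH 1 a p y|) ∧ ∑' y, |kerH 1 a p y| ≤ 2587 / 1000 := by
  have ht : (1 : ℝ) < 7 / 5 := by norm_num
  have hm : (0 : ℝ) < 2 - (4 : ℕ) * (((7 : ℝ) / 5 + ((7 : ℝ) / 5)⁻¹) / 2 - 1) := by norm_num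
  have h := rowSum_certificate (d := 4) ht hm ha phi Sbox phi_support blockSums_phi (U 1 boxT) residual_support p
  refine ⟨h.1, h.2.trans ?_⟩
  have hS2 : (S2Q : ℝ) ≤ ((206992365267364500521373518 : ℝ) ^ 2) / (5 : ℝ) ^ 40 := by
    have h1 : (S2Q : ℝ) = ((S2num : ℚ) : ℝ) / (5 : ℝ) ^ 40 := by rw [S2Q_eq]; push_cast; rfl
    rw [h1]
    refine div_le_div_of_nonneg_right ?_ (by positivity)
    exact_mod_cast S2num_le
  have hsqrt : Real.sqrt (∑ q ∈ U 1 boxT, (((7 : ℝ) / 5) ^ (∑ μ, ((blk 1 q) μ).natAbs) *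
      (lapRow phi q - ((2 : ℝ) ^ 4)⁻¹ * ∑ r ∈ B 1 (blk 1 q), lapRow phi r)) ^ 2) ≤ 206992365267364500521373518 / ((5 : ℝ) ^ 20 * 2 ^ 48) := by
    rw [residualNorm_eq, ← Real.sqrt_sq (by positivity : (0 : ℝ) ≤ 206992365267364500521373518 / ((5 : ℝ) ^ 20 * 2 ^ 48))]
    apply Real.sqrt_le_sqrt
    calc (S2Q : ℝ) / 2 ^ 96 ≤ (((206992365267364500521373518 : ℝ) ^ 2) / (5 : ℝ) ^ 40) / 2 ^ 96 := div_le_div_of_nonneg_right hS2 (by positivity)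
      _ = (206992365267364500521373518 / ((5 : ℝ) ^ 20 * 2 ^ 48)) ^ 2 := by ring
  have hCk : Real.sqrt (((((7 : ℝ) / 5) ^ 2 + 1) / (((7 : ℝ) / 5) ^ 2 - 1)) ^ (4 : ℕ)) = 1369/144 := by
    rw [show (((((7 : ℝ) / 5) ^ 2 + 1) / (((7 : ℝ) / 5) ^ 2 - 1)) ^ (4 : ℕ)) = ((1369/144 : ℝ)) ^ 2 by norm_num]
    exact Real.sqrt_sq (by norm_num)
  have hnear := nearField_le p
  have hmval : (2 : ℝ) - (4 : ℕ) * (((7 : ℝ) / 5 + ((7 : ℝ) / 5)⁻¹) / 2 - 1) = 62/35 := by norm_num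
  rw [hCk, hmval] at h ⊢
  have hcalc : (44770439763378 : ℝ) / 2 ^ 44 + 1369/144 * ((206992365267364500521373518 / ((5 : ℝ) ^ 20 * 2 ^ 48)) / (62/35)) ≤ 2587 / 1000 := by norm_num
  have herr : (1369/144 : ℝ) * (Real.sqrt (∑ q ∈ U 1 boxT, (((7 : ℝ) / 5) ^ (∑ μ, ((blk 1 q) μ).natAbs) *
      (lapRow phi q - ((2 : ℝ) ^ 4)⁻¹ * ∑ r ∈ B 1 (blk 1 q), lapRow phi r)) ^ 2) / (62/35)) ≤
      1369/144 * ((206992365267364500521373518 / ((5 : ℝ) ^ 20 * 2 ^ 48)) / (62/35)) := by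
    gcongr
  linarith [hnear, herr, hcalc]

end Summit.QuantumFields.BalabanUV.T4Continuum.NE7b.BlockSectionRowSumKernel
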